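import Literature.Probability.RandomPlanarGeometry.ConformalRestrictionFinal
import Literature.Probability.RandomPlanarGeometry.ArcApproximation
import Literature.Probability.RandomPlanarGeometry.KernelConvergence
import Literature.Probability.RandomPlanarGeometry.SLEScaleInvariance
import Literature.Probability.RandomPlanarGeometry.LocalMartingaleProofs
import HarnessLib

/-!
# [LSW] Theorem 8.4 (`κ = 8/3`) from TEN named facts: Lemma 2.1 and the §2 facts discharged

G. F. Lawler, O. Schramm, W. Werner, *Conformal restriction: the chordal case*, J. Amer. Math.
Soc. **16** (2003) 917–955, arXiv:math/0209343 (**[LSW]**, arXiv page numbers).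

`ConformalRestrictionFinal` reduces the target `Literature.Probability.RandomPlanarGeometry.LawlerSchrammWerner2003` to fourteen named
literature facts. Four of them concern [LSW] §2 and are now PROVED in the tree:

* `IsStarHull.existsUnique_isRestrictionMap` (`RestrictionHullsRiemannProofs`),
* `IsStarHull.exists_hasRestrictionDeriv` (`RestrictionHullsProofs`),
* `IsStarHull.exists_isHullProduct_plus_minus` (`RestrictionMapProofs`),
* and [LSW] Lemma 2.1 with the Lemma 3.5 convergence, in the packaged form `HasArcApprox A`
  that the measure-theoretic argument consumes, for every nonempty `A ∈ 𝒬₊ ∪ 𝒬₋`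
  (`Literature.Probability.RandomPlanarGeometry.hasArcApprox_of_plus_or_minus'`, `ArcApproximation`: the hulls `E_δ = D_δ · A` of
  [LSW]'s proof of Lemma 3.5, p. 13).

This proof-only file threads these through the assembly: primed versions of
`measure_avoid_hullProduct_of_plus_or_minus`, `IsArcHullMultiplicative.isHullMultiplicative`
(`RestrictionCovariance`), `ChordalFamily.isRestrictionMeasure_pullbackLaw`,
`LawlerSchrammWerner2003_unique_of_facts` (`RestrictionUniqueness`) without the hypothesis
`h21 : IsPlusHull.exists_antitone_isArcHull`, and

* `Literature.Probability.RandomPlanarGeometry.LawlerSchrammWerner2003_of_leaf_facts''` — the target from TEN named facts: six on the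
  SLE side (`isProjectiveLimit_preWienerMeasure`, `hasSLETrace_eight`, `hasSLETrace_of_ne_eight`,
  `tendsto_norm_sleTrace_atTop`, `identDistrib_sleTrace_scale`,
  `CritPerc.ae_isSimpleTrace_sleTrace_of_le_four (κ = 8/3)`) and four from [LSW]
  (`sle_restriction_eightThirds` = Thm. 6.1 for `κ = 8/3`, `HasRestrictionDeriv.tendsto_of_kernel`
  = the kernel-convergence remark p. 8, `exists_isRestrictionMeasure_of_isHullMultiplicative` =
  Prop. 3.3, `IsRestrictionMeasure.eq_five_eighths_of_outer_simple` = Thm. 7.3 / Cor. 8.6 with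
  (4.1));
* `Literature.Probability.RandomPlanarGeometry.LawlerSchrammWerner2003_of_leaf_facts'''` — the target from SEVEN named facts
  (`hasSLETrace_eight`, `hasSLETrace_of_ne_eight`, `tendsto_norm_sleTrace_atTop`,
  `CritPerc.ae_isSimpleTrace_sleTrace_of_le_four (κ = 8/3)`, `sle_restriction_eightThirds`,
  `exists_isRestrictionMeasure_of_isHullMultiplicative`,
  `IsRestrictionMeasure.eq_five_eighths_of_outer_simple`): the kernel-convergence fact, the
  projective-limit description of the pre-Wiener measure and SLE scaling in law are now fed by
  proofs (`KernelConvergence`, `LocalMartingaleProofs`, `SLEScaleInvariance`).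
-/

noncomputable section

open Set Filter Topology Metric MeasureTheory Complex
open UpperHalfPlane (upperHalfPlaneSet isOpen_upperHalfPlaneSet)
open scoped NNReal ENNReal

namespace Literature.Probability.RandomPlanarGeometry

open RestrictionConfig

/-- `P{K ∩ (A · A') = ∅} = P{K ∩ A = ∅} P{K ∩ A' = ∅}` for `A' ∈ 𝒬₊ ∪ 𝒬₋`, from
multiplicativity over smooth hulls — with [LSW] Lemma 2.1 PROVED (`hasArcApprox_of_plus_or_minus'`).
[cite: LawlerSchrammWerner2003Restriction, proof of Lemma 3.5 (p. 13)] -/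
theorem measure_avoid_hullProduct_of_plus_or_minus' (hexΦ : IsStarHull.existsUnique_isRestrictionMap)
    (hFa : isSimplyConnected_of_isConnected_compl)
    {P : Measure RestrictionConfig} [IsProbabilityMeasure P] (hP : IsArcHullMultiplicative P)
    {A A' : Set ℂ} (hA : IsStarHull A) (hA' : IsPlusHull A' ∨ IsMinusHull A')
    {Φ' : ConformalEquiv (upperHalfPlaneSet \ A') upperHalfPlaneSet} (hΦ' : IsRestrictionMap A' Φ') :
    P (avoid (hullProduct A A' Φ')) = P (avoid A) * P (avoid A') := by
  rcases A'.eq_empty_or_nonempty with rfl | hne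
  · exact measure_avoid_hullProduct_empty hexΦ hA hΦ'
  · have hA's : IsStarHull A' := hA'.elim (fun h ↦ h.1) (fun h ↦ h.1)
    exact measure_avoid_hullProduct_of_hasArcApprox hexΦ hFa hP hA hA's
      (hasArcApprox_of_plus_or_minus' hA' hne) hΦ'

/-- **[LSW] Prop. 3.3, (1) ⇒ (2), with Lemma 2.1 proved**: multiplicativity over smooth hulls
implies multiplicativity over all `*`-hulls. [cite: LawlerSchrammWerner2003Restriction, Prop. 3.3 (1)⇒(2) via Lemma 3.5 (pp. 12–13)] -/
theorem RestrictionConfig.IsArcHullMultiplicative.isHullMultiplicative'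
    (hfac : IsStarHull.exists_isHullProduct_plus_minus)
    (hexΦ : IsStarHull.existsUnique_isRestrictionMap)
    (hFa : isSimplyConnected_of_isConnected_compl)
    {P : Measure RestrictionConfig} [IsProbabilityMeasure P] (hP : IsArcHullMultiplicative P) :
    IsHullMultiplicative P := by
  intro A A' B hA hA' hB
  have hAc : IsClosed A := hA.isBoundedHull.isClosed
  obtain ⟨A₁, A₂, hA₁, hA₂, hprod⟩ := hfac hA'
  have hA₁c : IsClosed A₁ := hA₁.1.isBoundedHull.isClosed
  have hA₂c : IsClosed A₂ := hA₂.1.isBoundedHull.isClosed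
  obtain ⟨-, Φ₂, hΦ₂, hA'eq⟩ := hprod
  obtain ⟨Φ₁, hΦ₁, -⟩ := hexΦ hA₁.1
  have hA'' : A' = hullProduct A₁ A₂ Φ₂ := by
    refine hA'.isBoundedHull.eq_of_diff_eq (hA₁.1.hullProduct hA₂.1 hΦ₂).isBoundedHull ?_
    rw [hA'eq, diff_hullProduct hA₁c hA₂c]
  subst hA''
  have hΦ₁₂ : IsRestrictionMap (hullProduct A₁ A₂ Φ₂) (hullProductMap Φ₁ Φ₂ hA₁c hA₂c) :=
    IsRestrictionMap.hullProduct hA₁c hA₂c hΦ₁ hΦ₂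
  rw [avoid_eq_avoid_hullProduct hexΦ hA hA' hB hΦ₁₂,
    avoid_eq_of_diff_eq (diff_hullProduct_assoc hAc hA₁c hA₂c)]
  have e1 := measure_avoid_hullProduct_of_plus_or_minus' hexΦ hFa hP
    (hA.hullProduct hA₁.1 hΦ₁) (Or.inr hA₂) hΦ₂
  have e2 := measure_avoid_hullProduct_of_plus_or_minus' hexΦ hFa hP hA (Or.inl hA₁) hΦ₁
  have e3 := measure_avoid_hullProduct_of_plus_or_minus' hexΦ hFa hP hA₁.1 (Or.inr hA₂) hΦ₂
  rw [e1, e2, e3, mul_assoc]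

variable {D : DobrushinDomain} {φ : ConformalEquiv upperHalfPlaneSet D.carrier}

/-- **The pull-back law of a restriction family carried by simple curves is `P_{5/8}`**, with
Lemma 2.1 proved. [cite: LawlerSchrammWerner2003Restriction, Prop. 3.3 (pp. 10–11) and p. 5 result 2] -/
theorem ChordalFamily.isRestrictionMeasure_pullbackLaw' (hJCT : Literature.Topology.PlaneTopology.JordanCurveTheorem)
    (hJarc : Literature.Topology.PlaneTopology.JordanArcSeparation) (hC : JordanDomain.exists_continuousOn_extension)
    (hsc : ∀ D : JordanDomain, D.isSimplyConnected)
    (hRM : ∀ {U : Set ℂ}, exists_conformalEquiv_ball (U := U))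
    (hexΦ : IsStarHull.existsUnique_isRestrictionMap)
    (hFa : isSimplyConnected_of_isConnected_compl)
    (hfac : IsStarHull.exists_isHullProduct_plus_minus)
    (h33 : exists_isRestrictionMeasure_of_isHullMultiplicative)
    (h58 : IsRestrictionMeasure.eq_five_eighths_of_outer_simple)
    {P : ChordalFamily} (hP : P.IsChordal)
    (hcov : P.IsConformallyCovariant) (hres : P.IsHullRestriction) (hS : P.IsCarriedBySimpleCurves)
    (hφ : D.IsChordalUniformizing φ) :
    IsRestrictionMeasure (5 / 8) (ChordalFamily.pullbackLaw P D φ hJarc hC hφ) := by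
  haveI : IsProbabilityMeasure (P D) := (hP D).1
  have hcar : ∀ D : DobrushinDomain, ∀ᵐ c ∂P D, c ∈ chordalCarrier D :=
    ChordalFamily.ae_mem_chordalCarrier hP hS
  have hscale := ChordalFamily.isScaleInvariant_pullbackLaw hcov hcar hJarc hC hφ
  have harc := ChordalFamily.isArcHullMultiplicative_pullbackLaw hJCT hJarc hC hsc hRM hexΦ
    hP hcov hres hS hφ
  have hmult := harc.isHullMultiplicative' hfac hexΦ hFa
  obtain ⟨α, -, hαP⟩ := h33 _ inferInstance hscale hmult
  have hα : α = 5 / 8 := h58 hαP fun T hT hsub ↦ by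
    rw [ChordalFamily.pullbackLaw_apply _ hT]
    have : pullbackConfig hJarc hC hφ ⁻¹' T = univ :=
      eq_univ_of_forall fun c ↦ hsub (isSimplePath_pullbackConfig c)
    rw [this, measure_univ]
  subst hα
  exact hαP

/-- **[LSW] p. 5, result 2, first sentence, with Lemma 2.1 proved**: `LawlerSchrammWerner2003_unique`
from the Jordan curve theorem, arc non-separation, boundary extension of Riemann maps, and the
[LSW] facts Prop. 3.3 (`h33`) and Thm. 7.3/Cor. 8.6 (`h58`) (plus the §2 facts `hexΦ`, `hex`,
`hfac`, all discharged in the tree). [cite: LawlerSchrammWerner2003Restriction, p. 5 result 2 with Prop. 3.3 and Cor. 8.6] -/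
theorem LawlerSchrammWerner2003_unique_of_facts' (hJCT : Literature.Topology.PlaneTopology.JordanCurveTheorem)
    (hJarc : Literature.Topology.PlaneTopology.JordanArcSeparation) (hC : JordanDomain.exists_continuousOn_extension)
    (hsc : ∀ D : JordanDomain, D.isSimplyConnected)
    (hRM : ∀ {U : Set ℂ}, exists_conformalEquiv_ball (U := U))
    (hexΦ : IsStarHull.existsUnique_isRestrictionMap) (hex : IsStarHull.exists_hasRestrictionDeriv)
    (hFa : isSimplyConnected_of_isConnected_compl)
    (hfac : IsStarHull.exists_isHullProduct_plus_minus)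
    (h33 : exists_isRestrictionMeasure_of_isHullMultiplicative)
    (h58 : IsRestrictionMeasure.eq_five_eighths_of_outer_simple) :
    LawlerSchrammWerner2003_unique := by
  intro P Q hP hPcov hPres hPS hQ hQcov hQres hQS D
  haveI : IsProbabilityMeasure (P D) := (hP D).1
  haveI : IsProbabilityMeasure (Q D) := (hQ D).1
  obtain ⟨φ, hφ⟩ := MarkedDomain.exists_isChordalUniformizing_of_disc hsc hRM hC D
  have hPc : ∀ᵐ c ∂P D, c ∈ chordalCarrier D := ChordalFamily.ae_mem_chordalCarrier hP hPS D
  have hQc : ∀ᵐ c ∂Q D, c ∈ chordalCarrier D := ChordalFamily.ae_mem_chordalCarrier hQ hQS D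
  have hPt := ChordalFamily.isRestrictionMeasure_pullbackLaw' hJCT hJarc hC hsc hRM hexΦ hFa
    hfac h33 h58 hP hPcov hPres hPS hφ
  have hQt := ChordalFamily.isRestrictionMeasure_pullbackLaw' hJCT hJarc hC hsc hRM hexΦ hFa
    hfac h33 h58 hQ hQcov hQres hQS hφ
  have havoid : ∀ {A : Set ℂ}, IsStarHull A →
      ChordalFamily.pullbackLaw P D φ hJarc hC hφ (avoid A) =
        ChordalFamily.pullbackLaw Q D φ hJarc hC hφ (avoid A) := fun hA ↦ by
    obtain ⟨Φ, hΦ, -⟩ := hexΦ hA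
    obtain ⟨d, -, -, hd⟩ := hex hA hΦ
    rw [hPt.2 hA hΦ hd, hQt.2 hA hΦ hd]
  refine CurveClass.Measure.ext_of_missCode_injOn (fun n ↦ isClosed_imageTest hC n)
    measurableSet_chordalCarrier (injOn_missCode_imageTest hJarc hC hφ) hPc hQc fun s ↦ ?_
  obtain ⟨hanch, hcpt, hcl, h0⟩ := biUnion_anchoredSeq s
  rw [biUnion_imageTest]
  set T : Set ℂ := ⋃ n ∈ s, anchoredSeq n with hT
  have hTc : IsClosed T := hcpt.isClosed
  have hTb : Bornology.IsBounded T := hcpt.isBounded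
  rcases hanch with hempty | hanch
  · rw [hempty, image_empty]
    have : (CurveClass.rangeSubset (∅ : Set ℂ)ᶜ : Set (CurveClass ℂ)) = univ := by
      ext c; simp [CurveClass.mem_rangeSubset]
    rw [this, measure_univ, measure_univ]
  by_cases hfill : (0 : ℂ) ∈ hpFill T
  · rw [measure_rangeSubset_compl_image_eq_zero hC hφ P hPc hTc hcl h0 hfill,
      measure_rangeSubset_compl_image_eq_zero hC hφ Q hQc hTc hcl h0 hfill]
  · have hstar : IsStarHull (hpFill T) := isStarHull_hpFill hFa hTc hTb hanch.2 hfill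
    rw [measure_rangeSubset_compl_image_eq hJarc hC hφ P hPc hTc hTb hcl h0 hstar,
      measure_rangeSubset_compl_image_eq hJarc hC hφ Q hQc hTc hTb hcl h0 hstar, havoid hstar]

/-- **[LSW] Theorem 8.4 for `κ = 8/3` (with p. 5 result 2) from TEN named literature facts.**
Compared with `LawlerSchrammWerner2003_of_leaf_facts` (fourteen facts), the four [LSW] §2 facts
are fed by their proofs in the tree: `existsUnique_isRestrictionMap_holds`,
`exists_hasRestrictionDeriv_holds`, `exists_isHullProduct_plus_minus_holds`, and Lemma 2.1 via
`hasArcApprox_of_plus_or_minus'`. [cite: LawlerSchrammWerner2003Restriction, Theorem 8.4 (κ = 8/3, p. 38) with p. 5 result 2] -/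
theorem LawlerSchrammWerner2003_of_leaf_facts'' (hW : Process.isProjectiveLimit_preWienerMeasure)
    (h8 : hasSLETrace_eight) (hne : hasSLETrace_of_ne_eight) (htr : tendsto_norm_sleTrace_atTop)
    (hscale : identDistrib_sleTrace_scale)
    (h₆ : RandomPlanarGeometry.ae_isSimpleTrace_sleTrace_of_le_four (κ := (8 : ℝ≥0) / 3))
    (h61 : sle_restriction_eightThirds) (hFc : HasRestrictionDeriv.tendsto_of_kernel)
    (h33 : exists_isRestrictionMeasure_of_isHullMultiplicative)
    (h58 : IsRestrictionMeasure.eq_five_eighths_of_outer_simple) : LawlerSchrammWerner2003 := by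
  have hC : JordanDomain.exists_continuousOn_extension :=
    JordanDomain.exists_continuousOn_extension_of_jordanCurveTheorem Literature.Topology.PlaneTopology.JordanCurveTheorem_holds
  exact LawlerSchrammWerner2003_of_uniqueness hW h8 hne htr JordanDomain.isSimplyConnected_holds
    exists_conformalEquiv_ball_holds hC hscale h₆ Literature.Topology.PlaneTopology.JordanCurveTheorem_holds
    Literature.Topology.PlaneTopology.JordanArcSeparation_holds isSimplyConnected_of_isConnected_compl_holds h61
    IsStarHull.existsUnique_isRestrictionMap_holds IsStarHull.exists_hasRestrictionDeriv_holds hFc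
    (LawlerSchrammWerner2003_unique_of_facts' Literature.Topology.PlaneTopology.JordanCurveTheorem_holds Literature.Topology.PlaneTopology.JordanArcSeparation_holds hC
      JordanDomain.isSimplyConnected_holds exists_conformalEquiv_ball_holds
      IsStarHull.existsUnique_isRestrictionMap_holds IsStarHull.exists_hasRestrictionDeriv_holds
      isSimplyConnected_of_isConnected_compl_holds IsStarHull.exists_isHullProduct_plus_minus_holds h33 h58)

end Literature.Probability.RandomPlanarGeometry

namespace Literature.Probability.RandomPlanarGeometry

open scoped NNReal

/-- **[LSW] Theorem 8.4 for `κ = 8/3` (with p. 5 result 2) from SEVEN named literature facts.**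
As `LawlerSchrammWerner2003_of_leaf_facts''`, with three more hypotheses fed by proofs of the
tree: the kernel-convergence fact `HasRestrictionDeriv.tendsto_of_kernel` by
`tendsto_of_kernel_holds` (`KernelConvergence`), the projective-limit description of the
pre-Wiener measure `isProjectiveLimit_preWienerMeasure` by
`isProjectiveLimit_preWienerMeasure_holds` (`LocalMartingaleProofs`, Kolmogorov extension), and
SLE scaling in law `identDistrib_sleTrace_scale` by
`identDistrib_sleTrace_scale_of_trace_theorems` (`SLEScaleInvariance`, from `h8`, `hne`).
Remaining hypotheses — each a theory absent from the tree: SLE₈ is generated by a curve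
(`h8`, Lawler–Schramm–Werner (2004), Thm. 4.7), SLE_κ is generated by a curve for `κ ≠ 8`
(`hne`, Rohde–Schramm (2005), Thm. 5.1), transience of the trace (`htr`, RS05 Thm. 7.1), the
SLE_{8/3} trace is simple (`h₆`, RS05 Thm. 6.1), and from [LSW]: Thm. 6.1 (`h61`, restriction
formula for SLE_{8/3}), Prop. 3.3 (1) ⇒ (3) (`h33`) and p. 5 result 2 = Thm. 7.3 / Cor. 8.6
(`h58`).
[cite: LawlerSchrammWerner2003Restriction, Theorem 8.4 (κ = 8/3, p. 38) with p. 5 result 2] -/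
theorem LawlerSchrammWerner2003_of_leaf_facts''' (h8 : hasSLETrace_eight)
    (hne : hasSLETrace_of_ne_eight) (htr : tendsto_norm_sleTrace_atTop)
    (h₆ : RandomPlanarGeometry.ae_isSimpleTrace_sleTrace_of_le_four (κ := (8 : ℝ≥0) / 3))
    (h61 : sle_restriction_eightThirds)
    (h33 : exists_isRestrictionMeasure_of_isHullMultiplicative)
    (h58 : IsRestrictionMeasure.eq_five_eighths_of_outer_simple) : LawlerSchrammWerner2003 :=
  LawlerSchrammWerner2003_of_leaf_facts'' isProjectiveLimit_preWienerMeasure_holds h8 hne htr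
    (identDistrib_sleTrace_scale_of_trace_theorems h8 hne) h₆ h61
    HasRestrictionDeriv.tendsto_of_kernel_holds h33 h58

end Literature.Probability.RandomPlanarGeometry

end
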